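import Mathlib
import Summits.ABC.ABC.Theses.CongruentialReceptacle
import Summits.ABC.ABC.Theses.DefiniteXi

/-!
Sketch for crux-ideate stmt-ABC-1723 (BalancedFreySzpiro), ideator 2, round 1.
First lemmas of the two crux idea cards, typed over existing declarations.
-/

namespace Summit.ABC.ABC.Cruxes.BalancedFreySzpiro.Sketch

open Literature.NumberTheory.DiophantineGeometry

/-- Card `cell-exact-degree`: first lemma (elementary currency).  On the κ-balanced cell the
Frey j-invariant `j(E_{a,b}) = 2⁸ (a²+ab+b²)³ / (abc)²` is bounded above (and it is ≥ 1728
always): `2⁸ (a²+ab+b²)³ ≤ J₀(κ) · (abc)²` with `J₀(κ) = 6912·κ⁻⁴` admissible. -/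
def CellJBound : Prop :=
  ∀ κ : ℝ, 0 < κ → ∃ J₀ : ℝ, ∀ a b c : ℕ, IsABCTriple a b c → κ * (c : ℝ) ≤ (a : ℝ) →
    κ * (c : ℝ) ≤ (b : ℝ) →
      (2 : ℝ) ^ 8 * (((a : ℝ) ^ 2 + (a : ℝ) * (b : ℝ) + (b : ℝ) ^ 2) ^ 3)
        ≤ J₀ * (((a * b * c : ℕ) : ℝ) ^ 2)

/-- Card `cell-exact-degree`: the transfer target — Frey's degree conjecture restricted to the
κ-balanced cell (same vocabulary as `Summit.ABC.ABC.Theses.DefiniteXi.FreyDegreeBound`). -/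
def CellFreyDegreeBound : Prop :=
  ∀ κ : ℝ, 0 < κ → ∀ ε : ℝ, 0 < ε → ∃ C : ℝ, ∀ a b : ℤ, IsCoprime a b → 0 < a → 0 < b →
    κ * ((a + b : ℤ) : ℝ) ≤ (a : ℝ) → κ * ((a + b : ℤ) : ℝ) ≤ (b : ℝ) →
      ∀ (N : ℕ) [NeZero N],
        (Literature.NumberTheory.EllipticCurves.freyCurve a b).conductorNorm ℤ = N →
          ∃ D : Literature.NumberTheory.EllipticCurves.ModularForms.ModularParametrizationData
              (Literature.NumberTheory.EllipticCurves.freyCurve a b) N,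
            (D.deg : ℝ) ≤ C * (N : ℝ) ^ (2 + ε)

/-- The unrestricted degree conjecture implies the cell version (trivial monotonicity; the
content of the card is the converse-up-to-constants on the cell and the glue to the crux). -/
theorem cellFreyDegreeBound_of_freyDegreeBound
    (h : Summit.ABC.ABC.Theses.DefiniteXi.FreyDegreeBound) : CellFreyDegreeBound := by
  intro κ _ ε hε
  obtain ⟨C, hC⟩ := h ε hε
  refine ⟨C, ?_⟩
  intro a b hab ha hb _ _ N _ hN
  have hne : a * b * (a + b) ≠ 0 := by positivity
  exact hC a b hab hne N hN

/-- Card `gaussian-quartic-twist-cell`: first lemma — every triple `a + b = c` is the point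
`(−ab, ab²)` on the quartic twist `y² = x³ − (ab²c)·x` of the CM curve `y² = x³ − x`. -/
theorem quarticTwistPoint (a b c : ℤ) (h : a + b = c) :
    (a * b ^ 2) ^ 2 = (-(a * b)) ^ 3 - (a * b ^ 2 * c) * (-(a * b)) := by
  subst h; ring

/-- … and its translate by the 2-torsion point `(0,0)`: `(bc, b²c)` lies on the same curve. -/
theorem quarticTwistPoint' (a b c : ℤ) (h : a + b = c) :
    (b ^ 2 * c) ^ 2 = (b * c) ^ 3 - (a * b ^ 2 * c) * (b * c) := by
  subst h; ring

/-- Doubling lands in the image of the 2-isogeny: `x(2P) = ((2a+b)/2)²` because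
`(2a+b)⁴ − 16·a·b²·(a+b) = (4a²+4ab−b²)²` (the descent datum `(d₁,d₂) = (1, 16ab²c)`). -/
theorem quarticDescentSquare (a b : ℤ) :
    (2 * a + b) ^ 4 - 16 * (a * b ^ 2 * (a + b)) = (4 * a ^ 2 + 4 * a * b - b ^ 2) ^ 2 := by
  ring

/-- Card `gaussian-quartic-twist-cell`: the transfer target (RF₄ on the cell), elementary
currency.  Write `a b² c = n₀ · t⁴` with `n₀` fourth-power-free; the triple's point on the
minimal twist `E_{n₀}` is `(−ab/t², ab²/t³)`, with μ₄-coordinate (denominator) `t`.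
RF₄|cell: `c ≤ C · rad(n₀ · t)^{1+ε}` on κ-balanced triples — literally the crux in the
twist-family coordinates (`rad(n₀ t) = rad(abc)`), filed for its Mordell–Weil reading. -/
def CellRF4 : Prop :=
  ∀ κ : ℝ, 0 < κ → ∀ ε : ℝ, 0 < ε → ∃ C : ℝ, ∀ a b c : ℕ, IsABCTriple a b c →
    κ * (c : ℝ) ≤ (a : ℝ) → κ * (c : ℝ) ≤ (b : ℝ) → ∀ n₀ t : ℕ, 0 < t →
      n₀ * t ^ 4 = a * b ^ 2 * c → (∀ p : ℕ, p.Prime → ¬ p ^ 4 ∣ n₀) →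
        (c : ℝ) < C * ((UniqueFactorizationMonoid.radical (M := ℕ) (n₀ * t) : ℕ) : ℝ) ^ (1 + ε)

end Summit.ABC.ABC.Cruxes.BalancedFreySzpiro.Sketch
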